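import Summits.CriticalPhenomena.PercolationContinuityZ3.Theorems.PercNearOneGluingNoHeavyLowerTailSahiThreeCopy

/-!
# `NoHeavyLowerTail` (crux stmt-CriticalPhenomena-4575), Sahi programme: **3C-SAHI FOR NESTED SLOTS, coefficientwise, and the
# events form of the census conjecture** (`ThreeCopySahiSets ↔ ThreeCopySahi`)

Support file (Sahi cell, seat `prim-sahi-p1`, generation 53; `--supports stmt-CriticalPhenomena-4575`); companion of
`…SahiThreeCopy` / `…SahiThreeCopyBernstein`.  Pure proofs plus one definition (`ThreeCopySahiSets`, the census's statement verbatim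
in events form); no `sorry`, standard axioms.

1. **NESTED SLOTS** (`tc_nonneg_of_mul_eq`): for nonnegative monotone `f, g, h` on `{0,1}^d` with `g·h = g` and `h ≤ 1` — e.g. the
   indicators of up-sets `B ⊆ C`, or `B = C` — the three-copy Sahi coefficient is nonnegative at EVERY profile:
   `0 ≤ N_b(fg;1;1−h) − N_b(f;g;1−h) ≤ c_b(f,g,h)`.  So Sahi's `E₃(1_A,1_B,1_C) ≥ 0` with two nested events — the tree's law-level
   `sahiE3_nonneg_of_subset` — holds COEFFICIENTWISE in the minimal tensor-Bernstein multidegree `(3,…,3)` for every product measure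
   on every cube (CENSUS §175's conjecture 3C-SAHI on this class).  Proof: two instances of three-copy Harris (`N3_le_N3_mul`), one with
   the spectator `1 − h ≥ 0`: `c_b = 2N(fg) − N(f;g) − N(g;fh) − N(h;fg) + N(f;g;h) ≥ N(fg) − N(fg;h) − N(f;g) + N(f;g;h) = N(fg;1;h̄) − N(f;g;h̄)`.
   By the symmetry of `c_b` the nested pair may sit in any two slots (`tc_setInd_nonneg_of_subset₁₂/₁₃/₂₃`).
2. **EVENTS FORM** (`ThreeCopySahiSets`, `threeCopySahiSets_iff`): the census's statement "`c_b(1_A,1_B,1_C) ≥ 0` for all up-sets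
   `A, B, C ⊆ {0,1}^d` and all profiles" is EQUIVALENT to the functions form `ThreeCopySahi` of `…SahiThreeCopy` — `c_b` is trilinear
   (`tc_add_left`, `tc_smul_left`, `tc_listSum_left`) and a nonnegative monotone function on a finite poset is a nonnegative combination
   of indicators of up-sets (`exists_upperSet_decomposition`, [LiebSahi2021, Lemma 2.2]).
Nothing conjectural is asserted. [this work; conjecture and objects: CENSUS §175 W197 (prim-sahi-census gen 54)]
-/

namespace Summit.CriticalPhenomena.PercolationContinuityZ3.Theorems.SahiThreeCopy

open Finset Function Literature.Combinatorics.Sahi2008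
open scoped BigOperators

noncomputable section

variable {d : ℕ}

/-! ### §1 Linearity of `N_b` in the other slots, linearity of `c_b` in the first slot -/

/-- `N_b` is additive in the second copy. [this work] -/
theorem N3_add_mid (b : Fin d → ℕ) (f g g' h : Pt d → ℝ) : N3 b f (g + g') h = N3 b f g h + N3 b f g' h := by
  rw [N3_comm12 b f (g + g') h, N3_add_left, N3_comm12 b g f h, N3_comm12 b g' f h]

/-- `N_b` is additive in the third copy. [this work] -/
theorem N3_add_right (b : Fin d → ℕ) (f g h h' : Pt d → ℝ) : N3 b f g (h + h') = N3 b f g h + N3 b f g h' := by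
  rw [N3_comm13 b f g (h + h'), N3_add_left, N3_comm13 b h g f, N3_comm13 b h' g f]

/-- `N_b` is subtractive in the second copy. [this work] -/
theorem N3_sub_mid (b : Fin d → ℕ) (f g g' h : Pt d → ℝ) : N3 b f (g - g') h = N3 b f g h - N3 b f g' h := by
  have := N3_add_mid b f (g - g') g' h
  rw [sub_add_cancel] at this
  linarith

/-- `N_b` is subtractive in the third copy. [this work] -/
theorem N3_sub_right (b : Fin d → ℕ) (f g h h' : Pt d → ℝ) : N3 b f g (h - h') = N3 b f g h - N3 b f g h' := by
  have := N3_add_right b f g (h - h') h'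
  rw [sub_add_cancel] at this
  linarith

/-- `N_b` is homogeneous in the second copy. [this work] -/
theorem N3_smul_mid (b : Fin d → ℕ) (c : ℝ) (f g h : Pt d → ℝ) : N3 b f (c • g) h = c * N3 b f g h := by
  rw [N3_comm12 b f (c • g) h, N3_smul_left, N3_comm12 b g f h]

/-- `N_b` vanishes when the first copy carries the zero function. [this work] -/
theorem N3_zero_left (b : Fin d → ℕ) (g h : Pt d → ℝ) : N3 b 0 g h = 0 := by
  have := N3_smul_left b 0 (0 : Pt d → ℝ) g h
  rw [zero_smul, zero_mul] at this
  exact this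

/-- `c_b` is additive in its first argument. [this work] -/
theorem tc_add_left (b : Fin d → ℕ) (f f' g h : Pt d → ℝ) : tc b (f + f') g h = tc b f g h + tc b f' g h := by
  unfold tc
  have e1 : (f + f') * g * h = f * g * h + f' * g * h := by ring
  have e2 : (f + f') * h = f * h + f' * h := by ring
  have e3 : (f + f') * g = f * g + f' * g := by ring
  rw [e1, e2, e3, N3_add_left, N3_add_left, N3_add_left, N3_add_mid, N3_add_mid]
  ring

/-- `c_b` is homogeneous in its first argument. [this work] -/
theorem tc_smul_left (b : Fin d → ℕ) (c : ℝ) (f g h : Pt d → ℝ) : tc b (c • f) g h = c * tc b f g h := by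
  unfold tc
  have e1 : (c • f) * g * h = c • (f * g * h) := by rw [smul_mul_assoc, smul_mul_assoc]
  have e2 : (c • f) * h = c • (f * h) := smul_mul_assoc c f h
  have e3 : (c • f) * g = c • (f * g) := smul_mul_assoc c f g
  rw [e1, e2, e3, N3_smul_left, N3_smul_left, N3_smul_left, N3_smul_mid, N3_smul_mid]
  ring

/-- `c_b` vanishes when the first argument is the zero function. [this work] -/
theorem tc_zero_left (b : Fin d → ℕ) (g h : Pt d → ℝ) : tc b 0 g h = 0 := by
  have := tc_smul_left b 0 (0 : Pt d → ℝ) g h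
  rw [zero_smul, zero_mul] at this
  exact this

/-- `c_b` of a list sum of scaled functions in the first slot. [this work] -/
theorem tc_listSum_left (b : Fin d → ℕ) (g h : Pt d → ℝ) {ι : Type*} (F : ι → Pt d → ℝ) (c : ι → ℝ) :
    ∀ l : List ι, tc b (l.map fun i => c i • F i).sum g h = (l.map fun i => c i * tc b (F i) g h).sum
  | [] => by simp [tc_zero_left]
  | i :: l => by
    simp only [List.map_cons, List.sum_cons]
    rw [tc_add_left, tc_smul_left, tc_listSum_left b g h F c l]

/-! ### §2 Nested slots -/

/-- **3C-SAHI for nested slots, coefficientwise.**  If `f, g, h` are nonnegative and monotone, `g·h = g` and `h ≤ 1` (e.g.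
`g = 1_B`, `h = 1_C` with `B ⊆ C` up-sets), then for every profile `b`:
`0 ≤ N_b(fg;1;1−h) − N_b(f;g;1−h) ≤ c_b(f,g,h)`.  Two instances of three-copy Harris.  (Law level: `E₃ ≥ 0` for two nested
increasing events, `Literature…sahiE3_nonneg_of_subset`; here in the minimal tensor-Bernstein multidegree.) [this work] -/
theorem tc_nonneg_of_mul_eq (b : Fin d → ℕ) {f g h : Pt d → ℝ} (hf : ∀ x, 0 ≤ f x) (hfm : Monotone f) (hg : ∀ x, 0 ≤ g x)
    (hgm : Monotone g) (hh : ∀ x, 0 ≤ h x) (hhm : Monotone h) (hgh : g * h = g) (hh1 : ∀ x, h x ≤ 1) :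
    0 ≤ tc b f g h := by
  have one_nn : ∀ x : Pt d, (0 : ℝ) ≤ (1 : Pt d → ℝ) x := fun _ => zero_le_one
  have hbar : ∀ x : Pt d, (0 : ℝ) ≤ (1 - h) x := fun x => sub_nonneg.2 (hh1 x)
  have efgh : f * g * h = f * g := by rw [mul_assoc, hgh]
  have egfh : g * (f * h) = f * g := by rw [mul_left_comm, hgh, mul_comm]
  -- Harris 1: N(g; fh; 1) ≤ N(g·fh; 1; 1) = N(fg; 1; 1)
  have H1 := N3_le_N3_mul d b g (f * h) 1 hg hgm (fun x => mul_nonneg (hf x) (hh x)) (hfm.mul hhm hf hh) one_nn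
  rw [egfh] at H1
  -- Harris 2 with spectator 1 − h: N(f; g; 1−h) ≤ N(fg; 1; 1−h)
  have H2 := N3_le_N3_mul d b f g (1 - h) hf hfm hg hgm hbar
  -- splitting the idle slots along 1 = h + (1 − h)
  have s1 : N3 b (f * g) 1 1 = N3 b (f * g) h 1 + N3 b (f * g) (1 - h) 1 := by
    rw [← N3_add_mid, add_sub_cancel]
  have s2 : N3 b f g 1 = N3 b f g h + N3 b f g (1 - h) := by
    rw [← N3_add_right, add_sub_cancel]
  have s3 : N3 b (f * g) 1 (1 - h) = N3 b (f * g) (1 - h) 1 := N3_comm23 b (f * g) 1 (1 - h)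
  unfold tc
  rw [efgh, hgh, N3_comm12 b h (f * g) 1]
  linarith

/-- Events form: `c_b(1_A,1_B,1_C) ≥ 0` whenever `B ⊆ C` (all three up-sets; the nested pair in slots 2, 3). [this work] -/
theorem tc_setInd_nonneg_of_subset₂₃ (b : Fin d → ℕ) {A B C : Finset (Pt d)} (hA : IsUpperSet (A : Set (Pt d)))
    (hB : IsUpperSet (B : Set (Pt d))) (hC : IsUpperSet (C : Set (Pt d))) (hBC : B ⊆ C) :
    0 ≤ tc b (setInd A) (setInd B) (setInd C) := by
  refine tc_nonneg_of_mul_eq b (setInd_nonneg A) (monotone_setInd hA) (setInd_nonneg B) (monotone_setInd hB)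
    (setInd_nonneg C) (monotone_setInd hC) ?_ ?_
  · rw [setInd_mul, inter_eq_left.2 hBC]
  · intro x; unfold setInd; split_ifs <;> norm_num

/-- The nested pair in slots 1, 3: `c_b(1_A,1_B,1_C) ≥ 0` whenever `A ⊆ C`. [this work] -/
theorem tc_setInd_nonneg_of_subset₁₃ (b : Fin d → ℕ) {A B C : Finset (Pt d)} (hA : IsUpperSet (A : Set (Pt d)))
    (hB : IsUpperSet (B : Set (Pt d))) (hC : IsUpperSet (C : Set (Pt d))) (hAC : A ⊆ C) :
    0 ≤ tc b (setInd A) (setInd B) (setInd C) := by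
  rw [tc_comm12]
  exact tc_setInd_nonneg_of_subset₂₃ b hB hA hC hAC

/-- The nested pair in slots 1, 2: `c_b(1_A,1_B,1_C) ≥ 0` whenever `A ⊆ B`. [this work] -/
theorem tc_setInd_nonneg_of_subset₁₂ (b : Fin d → ℕ) {A B C : Finset (Pt d)} (hA : IsUpperSet (A : Set (Pt d)))
    (hB : IsUpperSet (B : Set (Pt d))) (hC : IsUpperSet (C : Set (Pt d))) (hAB : A ⊆ B) :
    0 ≤ tc b (setInd A) (setInd B) (setInd C) := by
  rw [tc_comm23, tc_comm12]
  exact tc_setInd_nonneg_of_subset₂₃ b hC hA hB hAB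

/-- Two EQUAL event slots: `c_b(1_A,1_B,1_B) ≥ 0` (coefficientwise `E₃(1_A,1_B,1_B) = (1−P(B))(2P(AB) − P(A)P(B)) ≥ 0`). [this work] -/
theorem tc_setInd_nonneg_of_eq₂₃ (b : Fin d → ℕ) {A B : Finset (Pt d)} (hA : IsUpperSet (A : Set (Pt d)))
    (hB : IsUpperSet (B : Set (Pt d))) : 0 ≤ tc b (setInd A) (setInd B) (setInd B) :=
  tc_setInd_nonneg_of_subset₂₃ b hA hB hB subset_rfl

/-! ### §3 The events form of 3C-SAHI and its equivalence with the functions form -/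

/-- **3C-SAHI, events form** (CENSUS §175 / W197 verbatim up to notation): for every `d`, all up-sets `A, B, C ⊆ {0,1}^d` and every
profile `b`, `0 ≤ c_b(1_A,1_B,1_C)`.  OPEN (exhaustive for `d ≤ 4`, 1.5·10¹⁰ random pairs at `d = 5, 6`, 0 negative); equivalent to
`ThreeCopySahi` (`threeCopySahiSets_iff`); an obligation / hypothesis, never a fact. [this work; CENSUS §175 W197] [status: open] -/
@[conjecture] def ThreeCopySahiSets : Prop :=
  ∀ (d : ℕ) (b : Fin d → ℕ) (A B C : Finset (Pt d)), IsUpperSet (A : Set (Pt d)) → IsUpperSet (B : Set (Pt d)) →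
    IsUpperSet (C : Set (Pt d)) → 0 ≤ tc b (setInd A) (setInd B) (setInd C)

/-- Functions form ⇒ events form (indicators of up-sets are nonnegative and monotone). [this work] -/
theorem threeCopySahiSets_of_threeCopySahi (H : ThreeCopySahi) : ThreeCopySahiSets :=
  fun d b A B C hA hB hC => H d b _ _ _ (setInd_nonneg A) (setInd_nonneg B) (setInd_nonneg C)
    (monotone_setInd hA) (monotone_setInd hB) (monotone_setInd hC)

/-- Layer cake in the first slot: if `c_b(1_U, g, h) ≥ 0` for every up-set `U`, then `c_b(f,g,h) ≥ 0` for every nonnegative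
monotone `f`. [this work; cite: LiebSahi2021, Lemma 2.2 (layer-cake reduction)] -/
theorem tc_nonneg_of_forall_setInd_left (b : Fin d → ℕ) {f : Pt d → ℝ} (g h : Pt d → ℝ) (hf : ∀ x, 0 ≤ f x)
    (hfm : Monotone f) (H : ∀ U : Finset (Pt d), IsUpperSet (U : Set (Pt d)) → 0 ≤ tc b (setInd U) g h) :
    0 ≤ tc b f g h := by
  classical
  obtain ⟨l, hl, hfl⟩ := exists_upperSet_decomposition f hf hfm
  rw [hfl]
  have e := tc_listSum_left b g h (fun p : ℝ × Finset (Pt d) => setInd p.2) (fun p => p.1) l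
  rw [e]
  refine List.sum_nonneg ?_
  intro x hx
  rw [List.mem_map] at hx
  obtain ⟨p, hp, rfl⟩ := hx
  exact mul_nonneg (hl p hp).1 (H p.2 (hl p hp).2)

/-- **Events form ⇔ functions form** of 3C-SAHI (trilinearity of `c_b` + finite layer cake in each slot, using the symmetry of
`c_b` to rotate the slots). [this work] -/
theorem threeCopySahiSets_iff : ThreeCopySahiSets ↔ ThreeCopySahi := by
  refine ⟨fun H d b f g h hf hg hh hfm hgm hhm => ?_, threeCopySahiSets_of_threeCopySahi⟩
  refine tc_nonneg_of_forall_setInd_left b g h hf hfm fun U hU => ?_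
  rw [tc_comm12]
  refine tc_nonneg_of_forall_setInd_left b (setInd U) h hg hgm fun V hV => ?_
  rw [tc_comm23, tc_comm12]
  refine tc_nonneg_of_forall_setInd_left b (setInd V) (setInd U) hh hhm fun W hW => ?_
  exact H d b W V U hW hV hU

/-- Hence the events form also implies Sahi's `C₃`-type conclusions drawn from `ThreeCopySahi` in `…SahiThreeCopyBernstein`;
here: events form ⇒ functions form. [this work] -/
theorem threeCopySahi_of_sets (H : ThreeCopySahiSets) : ThreeCopySahi := threeCopySahiSets_iff.1 H


/-! ### §4 Complements: `c_b(1−f,1−g,1−h) = H_b(f,g) + H_b(f,h) + H_b(g,h) − c_b(f,g,h)` (appended, p1 gen53) -/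

/-- `c_b` is subtractive in its first argument. [this work] -/
theorem tc_sub_left (b : Fin d → ℕ) (f f' g h : Pt d → ℝ) : tc b (f - f') g h = tc b f g h - tc b f' g h := by
  have := tc_add_left b (f - f') f' g h
  rw [sub_add_cancel] at this
  linarith

/-- Two constant slots kill `c_b`: `c_b(f,1,1) = 0` (coefficientwise `E₃(f,1,1) = 0`). [this work] -/
theorem tc_one_one (b : Fin d → ℕ) (f : Pt d → ℝ) : tc b f 1 1 = 0 := by
  rw [tc_one_right, mul_one, sub_self]

/-- **The complement identity**: for ANY real `f, g, h`,
`c_b(1−f, 1−g, 1−h) = [N_b(fg;1;1) − N_b(f;g;1)] + [N_b(fh;1;1) − N_b(f;h;1)] + [N_b(gh;1;1) − N_b(g;h;1)] − c_b(f,g,h)`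
— the coefficientwise form of `E₃(1−f,1−g,1−h) = Cov(f,g) + Cov(f,h) + Cov(g,h) − E₃(f,g,h)`.  Consequently 3C-SAHI is EQUIVALENT to
the two-sided sandwich `0 ≤ c_b(f,g,h) ≤ H_b(f,g) + H_b(f,h) + H_b(g,h)` (apply it to the complementary down-sets / reflected profile).
[this work] -/
theorem tc_compl (b : Fin d → ℕ) (f g h : Pt d → ℝ) :
    tc b (1 - f) (1 - g) (1 - h) = (N3 b (f * g) 1 1 - N3 b f g 1) + (N3 b (f * h) 1 1 - N3 b f h 1) +
      (N3 b (g * h) 1 1 - N3 b g h 1) - tc b f g h := by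
  -- expand slot 1, then slots 2 and 3 through the symmetries of `c_b`
  have s1 : ∀ u v : Pt d → ℝ, tc b (1 - f) u v = tc b 1 u v - tc b f u v := fun u v => tc_sub_left b 1 f u v
  have s2 : ∀ u v : Pt d → ℝ, tc b u (1 - g) v = tc b u 1 v - tc b u g v := by
    intro u v; rw [tc_comm12, tc_sub_left, tc_comm12 b 1 u v, tc_comm12 b g u v]
  have s3 : ∀ u v : Pt d → ℝ, tc b u v (1 - h) = tc b u v 1 - tc b u v h := by
    intro u v; rw [tc_comm23, tc_comm12, tc_sub_left, tc_comm12 b 1 u v, tc_comm23 b u 1 v, tc_comm12 b h u v, tc_comm23 b u h v]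
  have z1 : tc b (1 : Pt d → ℝ) 1 1 = 0 := tc_one_one b 1
  have z2 : tc b f 1 1 = 0 := tc_one_one b f
  have z3 : tc b 1 g 1 = 0 := by rw [tc_comm12, tc_one_one]
  have z4 : tc b 1 1 h = 0 := by rw [tc_comm23, tc_comm12, tc_one_one]
  have h12 : tc b f g 1 = N3 b (f * g) 1 1 - N3 b f g 1 := tc_one_right b f g
  have h13 : tc b f 1 h = N3 b (f * h) 1 1 - N3 b f h 1 := by rw [tc_comm23, tc_one_right]
  have h23 : tc b 1 g h = N3 b (g * h) 1 1 - N3 b g h 1 := by rw [tc_comm12, tc_comm23, tc_one_right]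
  rw [s1, s2, s2, s3, s3, s3, s3, z1, z2, z3, z4, h12, h13, h23]
  ring

/-- **The sandwich**: if the complementary triple satisfies 3C-SAHI at `b` (`0 ≤ c_b(1−f,1−g,1−h)`), then
`c_b(f,g,h) ≤ H_b(f,g) + H_b(f,h) + H_b(g,h)` (sum of the three pairwise three-copy Harris gaps). [this work] -/
theorem tc_le_sum_harris_of_compl (b : Fin d → ℕ) {f g h : Pt d → ℝ} (hc : 0 ≤ tc b (1 - f) (1 - g) (1 - h)) :
    tc b f g h ≤ (N3 b (f * g) 1 1 - N3 b f g 1) + (N3 b (f * h) 1 1 - N3 b f h 1) + (N3 b (g * h) 1 1 - N3 b g h 1) := by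
  rw [tc_compl] at hc
  linarith

end

end Summit.CriticalPhenomena.PercolationContinuityZ3.Theorems.SahiThreeCopy
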